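import Summits.CriticalPhenomena.CardyFormulaZ2.Theses.CardySelfRefinement
import Literature.Probability.Percolation.SelfRefinementMeasure
import Literature.Probability.Percolation.QuadCrossingSpaceZ2
import Literature.Probability.Percolation.QuadCrossingNoiseDiscrete

/-!
# Route CardySelfRefinement — `ExactEndpoints` (item stmt-CriticalPhenomena-10272)

The two endpoint identities of the self-refinement interpolation `M_k(ρ, c)` on `ℤ²`, as laws on
the Schramm–Smirnov space `ℋ_ℂ`:

* at `(ρ, c) = (1, 0)` the quads crossed by `M_k` drawn at mesh `η` have the law of the quads
  crossed by critical bond percolation on `ℤ²` drawn at mesh `k η`;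
* at `(ρ, c) = (0, 1/2)`, `M_k` drawn at mesh `η` IS critical bond percolation at mesh `η`.

The measure-level identities on bond configurations are in the tree
(`selfRefinementMeasure_one_zero : M_k(1,0) = P_{1/2}.map (refineConfig k)` and
`selfRefinementMeasure_zero_half : M_k(0,1/2) = P_{1/2}`, file
`Literature/Probability/Percolation/SelfRefinementMeasure.lean`, whose definitions the route's
`let`-prelude restates verbatim).  What is proved here is the geometry: the `k` collinear open
sub-edges of a coarse edge, drawn at mesh `δ`, realise exactly the coarse edge drawn at mesh
`k δ` (`openEdgeUnion_refineConfig`; `tupleBase` is floor division, so this also holds across the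
axes), hence `S_{refineConfig k ω}` at mesh `δ` is `S_ω` at mesh `k δ` (`z2QuadConfig_refineConfig`),
and the push-forward bookkeeping (`Measure.map_map` through the measurable encoding
`measurable_z2QuadConfig`, the a.s. inclusion `ω ⊆ E(ℤ²)` to pass between `configOf` and
`z2QuadConfig`, and the `√2` normalisation of `squareLatticeEmbedding`).

References: Beffara 2008 (arXiv:0708.3908) §5.1 (the two endpoints of a mixed model);
Schramm–Smirnov 2011 §1.3 (the encoding `ω ↦ S_ω`); Grimmett 1999 §1.3.
-/

noncomputable section

namespace Summit.CriticalPhenomena.CardyFormulaZ2.Theorems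

open Set MeasureTheory
open Literature.Probability.LatticeModels Literature.Probability.Percolation
open Literature.Probability.Percolation.QuadCrossing

/-! ### The line of a coarse edge and its subdivision points -/

/-- Segments between points of an affine line `ℝ → ℂ` are images of real intervals. [folklore] -/
theorem segment_affine_eq_image (L : ℝ →ᵃ[ℝ] ℂ) {a b : ℝ} (hab : a ≤ b) :
    segment ℝ (L a) (L b) = L '' Icc a b := by
  rw [← image_segment, segment_eq_Icc hab]

/-- The affine line `L = lineMap (δ·(k u)) (δ·(k u + e_d))` through the coarse edge `{u, u + e_d}`
of `kℤ²`, drawn at mesh `δ` on the fine lattice, sends the integer parameter `j` to the drawn fine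
vertex `k u + j e_d`. [folklore] -/
theorem lineMap_apply_intCast (k : ℕ) (δ : ℝ) (u : Site 2) (d : Fin 2) (j : ℤ) :
    AffineMap.lineMap (meshPoint δ ((k : ℤ) • u)) (meshPoint δ ((k : ℤ) • u + Pi.single d 1))
        (j : ℝ) = meshPoint δ ((k : ℤ) • u + Pi.single d j) := by
  apply Complex.ext <;> fin_cases d <;>
    simp [AffineMap.lineMap_apply_module', meshPoint, Site.toComplex] <;> ring

/-- The parameter `0` of that line is the coarse vertex `u` drawn at mesh `k δ`. [folklore] -/
theorem lineMap_apply_zero' (k : ℕ) (δ : ℝ) (u : Site 2) (d : Fin 2) :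
    AffineMap.lineMap (meshPoint δ ((k : ℤ) • u)) (meshPoint δ ((k : ℤ) • u + Pi.single d 1))
        (0 : ℝ) = meshPoint ((k : ℝ) * δ) u := by
  apply Complex.ext <;> fin_cases d <;>
    simp [AffineMap.lineMap_apply_module', meshPoint, Site.toComplex] <;> ring

/-- The parameter `k` of that line is the coarse vertex `u + e_d` drawn at mesh `k δ`. [folklore] -/
theorem lineMap_apply_natCast_self (k : ℕ) (δ : ℝ) (u : Site 2) (d : Fin 2) :
    AffineMap.lineMap (meshPoint δ ((k : ℤ) • u)) (meshPoint δ ((k : ℤ) • u + Pi.single d 1))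
        (k : ℝ) = meshPoint ((k : ℝ) * δ) (u + Pi.single d 1) := by
  apply Complex.ext <;> fin_cases d <;>
    simp [AffineMap.lineMap_apply_module', meshPoint, Site.toComplex] <;> ring

/-- The coarse edge `{u, u + e_d}` drawn at mesh `k δ` is the image of `[0, k]` under that line.
[folklore] -/
theorem segment_coarse_eq_image (k : ℕ) (δ : ℝ) (u : Site 2) (d : Fin 2) :
    segment ℝ (meshPoint ((k : ℝ) * δ) u) (meshPoint ((k : ℝ) * δ) (u + Pi.single d 1)) =
      AffineMap.lineMap (meshPoint δ ((k : ℤ) • u)) (meshPoint δ ((k : ℤ) • u + Pi.single d 1)) ''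
        Icc (0 : ℝ) k := by
  rw [← lineMap_apply_zero', ← lineMap_apply_natCast_self, segment_affine_eq_image _ (Nat.cast_nonneg k)]

/-- The `j`-th fine sub-edge `{k u + j e_d, k u + (j+1) e_d}` drawn at mesh `δ` is the image of
`[j, j + 1]` under that line. [folklore] -/
theorem segment_fine_eq_image (k : ℕ) (δ : ℝ) (u : Site 2) (d : Fin 2) (j : ℤ) :
    segment ℝ (meshPoint δ ((k : ℤ) • u + Pi.single d j))
        (meshPoint δ ((k : ℤ) • u + Pi.single d (j + 1))) =
      AffineMap.lineMap (meshPoint δ ((k : ℤ) • u)) (meshPoint δ ((k : ℤ) • u + Pi.single d 1)) ''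
        Icc (j : ℝ) ((j : ℝ) + 1) := by
  rw [← lineMap_apply_intCast k δ u d j, ← lineMap_apply_intCast k δ u d (j + 1),
    segment_affine_eq_image _ (by push_cast; linarith), Int.cast_add, Int.cast_one]

/-- A fine sub-edge of the coarse edge lies inside the coarse edge (as drawn segments). [folklore] -/
theorem segment_fine_subset_coarse (k : ℕ) (δ : ℝ) (u : Site 2) (d : Fin 2) {j : ℤ} (hj0 : 0 ≤ j)
    (hjk : j + 1 ≤ k) :
    segment ℝ (meshPoint δ ((k : ℤ) • u + Pi.single d j))
        (meshPoint δ ((k : ℤ) • u + Pi.single d (j + 1))) ⊆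
      segment ℝ (meshPoint ((k : ℝ) * δ) u) (meshPoint ((k : ℝ) * δ) (u + Pi.single d 1)) := by
  rw [segment_fine_eq_image, segment_coarse_eq_image]
  refine image_mono (Icc_subset_Icc (by exact_mod_cast hj0) ?_)
  exact_mod_cast hjk

/-- Every point of `[0, k]` lies in one of the unit intervals `[j, j + 1]`, `j < k`. [folklore] -/
theorem exists_nat_mem_Icc : ∀ (k : ℕ) {s : ℝ}, 0 < k → 0 ≤ s → s ≤ k →
    ∃ j : ℕ, j < k ∧ (j : ℝ) ≤ s ∧ s ≤ (j : ℝ) + 1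
  | 0, _, hk, _, _ => absurd hk (lt_irrefl 0)
  | (k + 1), s, _, hs0, hsk => by
    by_cases h : s ≤ k
    · rcases Nat.eq_zero_or_pos k with rfl | hk
      · exact ⟨0, Nat.zero_lt_one, by simpa using hs0, by push_cast at hsk ⊢; linarith⟩
      · obtain ⟨j, hj, h1, h2⟩ := exists_nat_mem_Icc k hk hs0 h
        exact ⟨j, by omega, h1, h2⟩
    · exact ⟨k, lt_add_one k, le_of_lt (not_le.1 h), by push_cast at hsk; linarith⟩

/-! ### Axial edges and their tuples -/

/-- An axial fine edge `(v, d)` is the `j`-th sub-edge, `0 ≤ j < k`, of the coarse edge based at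
its tuple base `u = tupleBase k (v, d)`: `v = k u + j e_d` (floor division). [folklore] -/
theorem exists_eq_smul_tupleBase_add {k : ℕ} (hk : 0 < k) {v : Site 2} {d : Fin 2}
    (hax : IsAxialEdge k (v, d)) :
    ∃ j : ℤ, 0 ≤ j ∧ j + 1 ≤ k ∧ v = (k : ℤ) • tupleBase k (v, d) + Pi.single d j := by
  have hk' : (k : ℤ) ≠ 0 := by exact_mod_cast hk.ne'
  refine ⟨v d % k, Int.emod_nonneg _ hk', ?_, ?_⟩
  · have := Int.emod_lt_of_pos (v d) (b := k) (by exact_mod_cast hk)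
    omega
  · funext i
    by_cases hi : i = d
    · subst hi
      simp only [Pi.add_apply, Pi.smul_apply, tupleBase_apply, smul_eq_mul, Pi.single_eq_same]
      have := Int.emod_def (v i) k
      omega
    · have hperp : (if d = 0 then (1 : Fin 2) else 0) = i := by
        fin_cases d <;> fin_cases i <;> simp_all
      have hdvd : (k : ℤ) ∣ v i := by
        have h := hax
        simp only [IsAxialEdge] at h
        rwa [hperp] at h
      simp only [Pi.add_apply, Pi.smul_apply, tupleBase_apply, smul_eq_mul, Pi.single_eq_of_ne hi,
        add_zero]
      exact (Int.mul_ediv_cancel' hdvd).symm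

/-- The `j`-th sub-edge `(k u + j e_d, d)`, `0 ≤ j < k`, of a coarse edge is axial. [folklore] -/
theorem isAxialEdge_smul_add {k : ℕ} (u : Site 2) (d : Fin 2) (j : ℤ) :
    IsAxialEdge k ((k : ℤ) • u + Pi.single d j, d) := by
  fin_cases d <;> simp [IsAxialEdge]

/-- The tuple base of the `j`-th sub-edge `(k u + j e_d, d)`, `0 ≤ j < k`, is `u`. [folklore] -/
theorem tupleBase_smul_add {k : ℕ} (hk : 0 < k) (u : Site 2) (d : Fin 2) {j : ℤ} (hj0 : 0 ≤ j)
    (hjk : j < k) : tupleBase k ((k : ℤ) • u + Pi.single d j, d) = u := by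
  have hk' : (k : ℤ) ≠ 0 := by exact_mod_cast hk.ne'
  funext i
  by_cases hi : i = d
  · subst hi
    simp only [tupleBase_apply, Pi.add_apply, Pi.smul_apply, smul_eq_mul, Pi.single_eq_same]
    rw [add_comm, Int.add_mul_ediv_left _ _ hk', Int.ediv_eq_zero_of_lt hj0 hjk, zero_add]
  · simp only [tupleBase_apply, Pi.add_apply, Pi.smul_apply, smul_eq_mul, Pi.single_eq_of_ne hi,
      add_zero]
    exact Int.mul_ediv_cancel_left _ hk'

/-- `x ∼ x + e_d` in `ℤ²`. [folklore] -/
theorem zdGraph_two_adj_add_single (x : Site 2) (d : Fin 2) : (zdGraph 2).Adj x (x + Pi.single d 1) :=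
  (zdGraph_adj_iff _ _).2 ⟨d, Or.inl rfl⟩

/-- An edge of `ℤ²` is a `cornerEdge`. [folklore] -/
theorem exists_cornerEdge_eq_of_adj {x y : Site 2} (h : (zdGraph 2).Adj x y) :
    ∃ e : Site 2 × Fin 2, cornerEdge e = s(x, y) :=
  mem_edgeSet_iff_exists_cornerEdge.1 ((SimpleGraph.mem_edgeSet _).2 h)

/-- Equal unordered pairs span the same drawn segment. [folklore] -/
theorem segment_meshPoint_eq_of_sym2_eq (δ : ℝ) {x y v w : Site 2} (h : s(x, y) = s(v, w)) :
    segment ℝ (meshPoint δ x) (meshPoint δ y) = segment ℝ (meshPoint δ v) (meshPoint δ w) := by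
  rcases Sym2.eq_iff.1 h with ⟨rfl, rfl⟩ | ⟨rfl, rfl⟩
  · rfl
  · exact segment_symm ℝ _ _

/-! ### The geometric identity -/

/-- **`k` collinear sub-edges are one edge.**  The drawn open edges, at mesh `δ`, of the
subdivided configuration `refineConfig k ω` (the axial sub-edge is open iff its coarse edge is
open in `ω`; interior edges closed) are exactly the drawn open edges of `ω` at mesh `k δ`
(`k ≥ 1`; `tupleBase` is floor division, which groups the sub-edges correctly on both sides of
the axes). [folklore] -/
theorem openEdgeUnion_refineConfig {k : ℕ} (hk : 0 < k) (δ : ℝ) (ω : BondConfig (Site 2)) :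
    openEdgeUnion δ (refineConfig k ω) = openEdgeUnion ((k : ℝ) * δ) ω := by
  ext z
  simp only [mem_openEdgeUnion_iff]
  constructor
  · rintro ⟨x, y, hxy, hmem, hz⟩
    obtain ⟨⟨v, d⟩, he⟩ := exists_cornerEdge_eq_of_adj hxy
    rw [← he, cornerEdge_mem_refineConfig_iff] at hmem
    obtain ⟨hax, hω⟩ := hmem
    rw [← segment_meshPoint_eq_of_sym2_eq δ he] at hz
    obtain ⟨j, hj0, hjk, hv⟩ := exists_eq_smul_tupleBase_add hk hax
    set u := tupleBase k (v, d) with hu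
    refine ⟨u, u + Pi.single d 1, zdGraph_two_adj_add_single u d, hω, ?_⟩
    refine segment_fine_subset_coarse k δ u d hj0 hjk ?_
    have hv' : v + Pi.single d 1 = (k : ℤ) • u + Pi.single d (j + 1) := by
      rw [hv, add_assoc, ← Pi.single_add]
    rwa [hv', hv] at hz
  · rintro ⟨x, y, hxy, hmem, hz⟩
    obtain ⟨⟨u, d⟩, he⟩ := exists_cornerEdge_eq_of_adj hxy
    rw [← he] at hmem
    rw [← segment_meshPoint_eq_of_sym2_eq _ he] at hz
    change z ∈ segment ℝ (meshPoint ((k : ℝ) * δ) u) (meshPoint ((k : ℝ) * δ) (u + Pi.single d 1)) at hz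
    rw [segment_coarse_eq_image] at hz
    obtain ⟨s, ⟨hs0, hsk⟩, rfl⟩ := hz
    obtain ⟨j, hjk, hjs, hsj⟩ := exists_nat_mem_Icc k hk hs0 hsk
    refine ⟨(k : ℤ) • u + Pi.single d (j : ℤ), (k : ℤ) • u + Pi.single d (j : ℤ) + Pi.single d 1,
      zdGraph_two_adj_add_single _ d, ?_, ?_⟩
    · change cornerEdge ((k : ℤ) • u + Pi.single d (j : ℤ), d) ∈ refineConfig k ω
      rw [cornerEdge_mem_refineConfig_iff]
      refine ⟨isAxialEdge_smul_add u d j, ?_⟩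
      rw [tupleBase_smul_add hk u d (Int.natCast_nonneg j) (by exact_mod_cast hjk)]
      exact hmem
    · rw [add_assoc, ← Pi.single_add, segment_fine_eq_image]
      exact ⟨s, ⟨by exact_mod_cast hjs, by exact_mod_cast hsj⟩, rfl⟩

/-- The same identity in `ℋ_ℂ`: the point `S` of the subdivided configuration at mesh `δ` is the
point of the coarse configuration at mesh `k δ`. [folklore] -/
theorem z2QuadConfig_refineConfig {k : ℕ} (hk : 0 < k) (δ : ℝ) (ω : BondConfig (Site 2)) :
    z2QuadConfig univ δ (refineConfig k ω) = z2QuadConfig univ ((k : ℝ) * δ) ω := by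
  apply SetLike.coe_injective
  rw [coe_z2QuadConfig, coe_z2QuadConfig, openEdgeUnion_refineConfig hk]

/-! ### The push-forward identities -/

/-- For a configuration of lattice edges, the route's encoding `configOf squareLatticeEmbedding.z η`
(all pairs drawn, vertex spacing `√2`) is the tree's `z2QuadConfig` at mesh `η √2`. [folklore] -/
theorem configOf_squareLatticeEmbedding_eq_z2QuadConfig {ω : BondConfig (Site 2)}
    (hω : ω ⊆ (zdGraph 2).edgeSet) (η : ℝ) :
    configOf squareLatticeEmbedding.z η univ ω = z2QuadConfig univ (η * Real.sqrt 2) ω := by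
  rw [configOf_squareLatticeEmbedding, z2QuadConfig, inter_eq_left.mpr hω]

/-- **Endpoint `(ρ, c) = (1, 0)`**: the law on `ℋ_ℂ` of the quads crossed by `M_k(1, 0)` drawn at
mesh `η > 0` is the law of the quads crossed by critical bond percolation on `ℤ²` drawn at mesh
`k η` (`k ≥ 1`). [folklore] -/
theorem map_configOf_selfRefinementMeasure_one_zero {k : ℕ} (hk : 0 < k) {η : ℝ} (hη : 0 < η) :
    (selfRefinementMeasure k 1 0).map (configOf squareLatticeEmbedding.z η (univ : Set ℂ)) =
      (bondPercolation (zdGraph 2) half).map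
        (configOf squareLatticeEmbedding.z ((k : ℝ) * η) (univ : Set ℂ)) := by
  have h2 : 0 < Real.sqrt 2 := Real.sqrt_pos.2 two_pos
  have hae1 : (configOf squareLatticeEmbedding.z η (univ : Set ℂ) : BondConfig (Site 2) → _)
      =ᵐ[selfRefinementMeasure k 1 0] z2QuadConfig univ (η * Real.sqrt 2) := by
    filter_upwards [selfRefinementMeasure_ae_subset_edgeSet k 1 0] with ω hω
    exact configOf_squareLatticeEmbedding_eq_z2QuadConfig hω η
  have hae2 : (configOf squareLatticeEmbedding.z ((k : ℝ) * η) (univ : Set ℂ) : BondConfig (Site 2) → _)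
      =ᵐ[bondPercolation (zdGraph 2) half] z2QuadConfig univ ((k : ℝ) * (η * Real.sqrt 2)) := by
    have hsub : ∀ᵐ ω ∂bondPercolation (zdGraph 2) half, ω ⊆ (zdGraph 2).edgeSet :=
      ProbabilityTheory.setBernoulli_ae_subset
    filter_upwards [hsub] with ω hω
    rw [configOf_squareLatticeEmbedding_eq_z2QuadConfig hω, mul_assoc]
  rw [Measure.map_congr hae1, Measure.map_congr hae2, selfRefinementMeasure_one_zero,
    Measure.map_map (measurable_z2QuadConfig isOpen_univ (mul_pos hη h2)) (measurable_refineConfig k)]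
  congr 1
  funext ω
  exact z2QuadConfig_refineConfig hk _ ω

/-- **Endpoint `(ρ, c) = (0, 1/2)`**: `M_k(0, 1/2)` drawn at mesh `η` has the law of critical bond
percolation on `ℤ²` drawn at mesh `η`, on `ℋ_ℂ` (indeed the two measures on bond configurations
coincide, `selfRefinementMeasure_zero_half`). [folklore] -/
theorem map_configOf_selfRefinementMeasure_zero_half (k : ℕ) (η : ℝ) :
    (selfRefinementMeasure k 0 (1 / 2)).map (configOf squareLatticeEmbedding.z η (univ : Set ℂ)) =
      (bondPercolation (zdGraph 2) half).map (configOf squareLatticeEmbedding.z η (univ : Set ℂ)) := by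
  rw [selfRefinementMeasure_zero_half]

/-- **Route item `ExactEndpoints` (stmt-CriticalPhenomena-10272), proved.**  The route's
`let`-prelude `ax, tb, opn, cfg, prm, M` is, term for term, `IsAxialEdge`, `tupleBase`,
`RefinementOpen`, `refinementConfig`, `refinementParam`, `selfRefinementMeasure` of
`SelfRefinementMeasure.lean`, so the statement is the conjunction of
`map_configOf_selfRefinementMeasure_one_zero` and `map_configOf_selfRefinementMeasure_zero_half`
for `k = 2, 3`. [folklore] -/
theorem exactEndpoints_proof :
    Summit.CriticalPhenomena.CardyFormulaZ2.Theses.CardySelfRefinement.ExactEndpoints := by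
  unfold Summit.CriticalPhenomena.CardyFormulaZ2.Theses.CardySelfRefinement.ExactEndpoints
  intro ax tb opn cfg prm M k hk η hη
  have hk0 : 0 < k := by rcases hk with rfl | rfl <;> norm_num
  exact ⟨map_configOf_selfRefinementMeasure_one_zero hk0 hη,
    map_configOf_selfRefinementMeasure_zero_half k η⟩

end Summit.CriticalPhenomena.CardyFormulaZ2.Theorems

end
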